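import Literature.MathematicalPhysics.QuantumLattice.SU2HaarSmallBall
import Literature.MathematicalPhysics.QuantumLattice.SU2HaarChart
import HarnessLib

/-!
# Haar measure on `SU(2)`: small balls around the identity from above, and the involutions of `SU(2)`

Sibling proof file of `SU2Haar.lean` / `SU2HaarSmallBall.lean` (all statements proved, no
definitions). Two elementary facts about `SU(2) = Matrix.specialUnitaryGroup (Fin 2) ℂ`:

* `haarProbability_su2_two_sub_trace_lt_le` — a polynomial UPPER bound for the normalised Haar
  measure of trace-neighbourhoods of the identity,

    `Haar {U : 2 − Re tr U < r²} ≤ 4 r³`  for `0 < r`,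

  the companion of the lower bound `le_haarProbability_su2_two_sub_trace_le` (`≥ η²/16` for the
  closed neighbourhood `{2 − Re tr U ≤ η}`): by the ball-cone description of Haar measure
  (`haarProbability_su2_eq_su2BallMeasure`: Haar is the law of the radial projection `quatToSU2 x`
  of `x` uniform in the unit ball of `ℍ`), the cone over the neighbourhood inside the unit ball lies
  in the cylinder `{|re x| < 1} × {|im x|_∞ < r}` (`2 − Re tr (x/‖x‖) = 2(‖x‖ − re x)/‖x‖ < r²` forces
  `|im x|² = (‖x‖ − re x)(‖x‖ + re x) < r² ‖x‖² < r²`), whose volume `2 · (2r)³ = 16 r³` divided by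
  `vol(B⁴) = π²/2` is `32 r³/π² ≤ 4 r³`. On `SU(2)` the squared Frobenius distance to the identity is
  `‖U − 1‖²_F = 2(2 − Re tr U)`, so this is the ball `‖U − 1‖_F < √2 r`; the true order is `r³`.
* `coe_eq_one_or_eq_neg_one_of_mul_self_eq_one` — the only involutions of `SU(2)` are `±1`
  (`U = quatMatrix q` with `q² = 1` in the division ring `ℍ`; first rows of `quatMatrix` compared inline).

These are the two inputs of the Haar "dimension gap" of `SU(2)` (ball growth of order `≤ 4`, thin
involutions of order `3`) used on the summit side (`ConvexGribovBody.BrascampLiebVacuumSC`, line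
`SketchIdeator1`). References: Sepanski, *Compact Lie Groups*, §1.1.4 (`SU(2) ≅ S³`); Chatterjee,
arXiv:2401.10507, §3.2 (Haar on `SU(2)` as the uniform measure on `S³`).
-/

open MeasureTheory Quaternion Filter Topology Set
open scoped Quaternion ENNReal

noncomputable section

namespace Literature.MathematicalPhysics.QuantumLattice

/-! ### The involutions of `SU(2)` -/

/-- **The involutions of `SU(2)` are `±1`**: if `U ∈ SU(2)` and `U² = 1` then `U = 1` or `U = −1`
(as matrices). Proof: `U = quatMatrix q` for a unit quaternion `q`, `q² = 1`, and
`(q − 1)(q + 1) = 0` in the division ring `ℍ`. [folklore] -/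
theorem coe_eq_one_or_eq_neg_one_of_mul_self_eq_one {U : (Matrix.specialUnitaryGroup (Fin 2) ℂ)} (h : U * U = 1) :
    (U : Matrix (Fin 2) (Fin 2) ℂ) = 1 ∨ (U : Matrix (Fin 2) (Fin 2) ℂ) = -1 := by
  set q : ℍ := su2Quat U with hq
  have hU : quatMatrix q = (U : Matrix (Fin 2) (Fin 2) ℂ) := quatMatrix_su2Quat U
  have hqq : quatMatrix (q * q) = quatMatrix 1 := by
    rw [quatMatrix_mul, hU, quatMatrix_one, ← Submonoid.coe_mul, h]
    rfl
  have hq2 : q * q = 1 := by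
    -- compare the first rows (cf. `QuantumFieldTheory.quatMatrix_injective`, not imported here to keep
    -- this file's import closure inside `QuantumLattice.SU2Haar*`)
    have h00 := congrFun (congrFun hqq 0) 0
    have h01 := congrFun (congrFun hqq 0) 1
    simp only [quatMatrix_apply_00, quatMatrix_apply_01, Complex.mk.injEq] at h00 h01
    ext
    · exact h00.1
    · exact h00.2
    · exact h01.1
    · exact h01.2
  have hfac : (q - 1) * (q + 1) = 0 := by
    rw [sub_mul, mul_add, mul_add, one_mul, one_mul, mul_one, hq2]
    abel
  rcases mul_eq_zero.1 hfac with h1 | h1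
  · left
    rw [← hU, sub_eq_zero.1 h1, quatMatrix_one]
  · right
    rw [← hU, eq_neg_of_add_eq_zero_left h1, quatMatrix_neg, quatMatrix_one]

/-! ### Small balls around the identity have polynomially small Haar measure -/

/-- `|re x| ≤ ‖x‖` for a quaternion. [folklore] -/
theorem abs_re_le_norm (x : ℍ) : |x.re| ≤ ‖x‖ := by
  have h : x.re ^ 2 ≤ ‖x‖ ^ 2 := by
    rw [sq_norm_eq_sum_sq]
    nlinarith [sq_nonneg x.imI, sq_nonneg x.imJ, sq_nonneg x.imK]
  exact abs_le_of_sq_le_sq' h (norm_nonneg _) |> fun h' => abs_le.2 h'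

/-- **The cone over a trace-neighbourhood lies in a thin cylinder.** If `‖x‖ < 1` and the radial
projection of `x` satisfies `2 − Re tr (quatToSU2 x) < r²`, then `|im x|² < r²`
(`2 − Re tr = 2(‖x‖ − re x)/‖x‖` and `|im x|² = (‖x‖ − re x)(‖x‖ + re x) ≤ 2‖x‖(‖x‖ − re x)`). [folklore] -/
theorem im_sq_lt_of_two_sub_trace_re_quatToSU2_lt {r : ℝ} {x : ℍ} (hx1 : ‖x‖ < 1)
    (hT : 2 - (((quatToSU2 x : (Matrix.specialUnitaryGroup (Fin 2) ℂ)) : Matrix (Fin 2) (Fin 2) ℂ).trace).re < r ^ 2) :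
    x.imI ^ 2 + x.imJ ^ 2 + x.imK ^ 2 < r ^ 2 := by
  by_cases hx : x = 0
  · subst hx
    have h0 : (((quatToSU2 (0 : ℍ) : (Matrix.specialUnitaryGroup (Fin 2) ℂ)) : Matrix (Fin 2) (Fin 2) ℂ).trace).re = 2 := by
      rw [quatToSU2, dif_pos rfl]
      simp [Matrix.trace]
    rw [h0] at hT
    simpa using hT
  · rw [trace_quatToSU2_re hx] at hT
    have hn : 0 < ‖x‖ := norm_pos_iff.2 hx
    have hre := abs_le.1 (abs_re_le_norm x)
    -- `‖x‖ − re x < r² ‖x‖ / 2`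
    have hkey : ‖x‖ - x.re < r ^ 2 * ‖x‖ / 2 := by
      have h1 : 2 - 2 * (‖x‖⁻¹ * x.re) = 2 * (‖x‖ - x.re) / ‖x‖ := by
        field_simp
      rw [h1, div_lt_iff₀ hn] at hT
      linarith
    have him : x.imI ^ 2 + x.imJ ^ 2 + x.imK ^ 2 = (‖x‖ - x.re) * (‖x‖ + x.re) := by
      have := sq_norm_eq_sum_sq x
      nlinarith
    rw [him]
    have h2 : (‖x‖ - x.re) * (‖x‖ + x.re) ≤ (‖x‖ - x.re) * (2 * ‖x‖) :=
      mul_le_mul_of_nonneg_left (by linarith) (by linarith)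
    have h3 : (‖x‖ - x.re) * (2 * ‖x‖) ≤ r ^ 2 * ‖x‖ / 2 * (2 * ‖x‖) :=
      mul_le_mul_of_nonneg_right hkey.le (by linarith)
    have h4 : r ^ 2 * ‖x‖ / 2 * (2 * ‖x‖) = r ^ 2 * ‖x‖ ^ 2 := by ring
    have hr2 : 0 < r ^ 2 := by
      have h6 : 0 < r ^ 2 * ‖x‖ / 2 := lt_of_le_of_lt (sub_nonneg.2 hre.2) hkey
      have h7 : 0 < r ^ 2 * (‖x‖ / 2) := by rw [← mul_div_assoc]; exact h6
      exact pos_of_mul_pos_left h7 (by linarith)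
    have h8 : ‖x‖ ^ 2 < 1 := by nlinarith
    have h9 : r ^ 2 * ‖x‖ ^ 2 < r ^ 2 := by nlinarith
    linarith

/-- **Upper bound for small balls around the identity.** For `0 < r`,
`Haar {U ∈ SU(2) : 2 − Re tr U < r²} ≤ 4 r³`: the cone over this set inside the unit quaternion ball
lies in the cylinder `(−1, 1) × {|im|_∞ < r}` of volume `16 r³`, and `vol(B⁴) = π²/2 ≥ 4`.
[folklore] -/
theorem haarProbability_su2_two_sub_trace_lt_le {r : ℝ} (hr : 0 < r) :
    QuantumFieldTheory.haarProbability (Matrix.specialUnitaryGroup (Fin 2) ℂ)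
        {U : (Matrix.specialUnitaryGroup (Fin 2) ℂ) | 2 - ((U : Matrix (Fin 2) (Fin 2) ℂ).trace).re < r ^ 2} ≤
      ENNReal.ofReal (4 * r ^ 3) := by
  letI : MeasurableSpace ℍ := Literature.Analysis.FluidPDE.Tao2016.quatMeasurableSpace
  haveI : BorelSpace ℍ := Literature.Analysis.FluidPDE.Tao2016.quatBorelSpace
  set T : Set (Matrix.specialUnitaryGroup (Fin 2) ℂ) := {U : (Matrix.specialUnitaryGroup (Fin 2) ℂ) | 2 - ((U : Matrix (Fin 2) (Fin 2) ℂ).trace).re < r ^ 2} with hT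
  have hTm : MeasurableSet T := by
    refine (isOpen_lt ?_ continuous_const).measurableSet
    exact continuous_const.sub
      (Complex.continuous_re.comp (continuous_subtype_val.matrix_trace))
  -- the cylinder in the coordinates `ℍ ≃ ℝ × ℝ³`
  set Cyl : Set (ℝ × (Fin 3 → ℝ)) := Set.Ioo (-1 : ℝ) 1 ×ˢ Metric.ball (0 : Fin 3 → ℝ) r with hCyl
  have hCylm : MeasurableSet Cyl := measurableSet_Ioo.prod Metric.isOpen_ball.measurableSet
  have hsub : quatToSU2 ⁻¹' T ∩ Metric.ball 0 1 ⊆ quatReImEquiv ⁻¹' Cyl := by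
    rintro x ⟨hxT, hx1⟩
    rw [Metric.mem_ball, dist_zero_right] at hx1
    have him := im_sq_lt_of_two_sub_trace_re_quatToSU2_lt hx1 hxT
    have hre := abs_lt.1 (lt_of_le_of_lt (abs_re_le_norm x) hx1)
    rw [Set.mem_preimage, quatReImEquiv_apply, hCyl, Set.mem_prod]
    refine ⟨⟨hre.1, hre.2⟩, ?_⟩
    rw [Metric.mem_ball, dist_zero_right, pi_norm_lt_iff hr]
    have hI : |x.imI| < r :=
      abs_lt_of_sq_lt_sq (by nlinarith [sq_nonneg x.imJ, sq_nonneg x.imK]) hr.le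
    have hJ : |x.imJ| < r :=
      abs_lt_of_sq_lt_sq (by nlinarith [sq_nonneg x.imI, sq_nonneg x.imK]) hr.le
    have hK : |x.imK| < r :=
      abs_lt_of_sq_lt_sq (by nlinarith [sq_nonneg x.imI, sq_nonneg x.imJ]) hr.le
    intro i
    rw [Real.norm_eq_abs]
    fin_cases i
    · simpa using hI
    · simpa using hJ
    · simpa using hK
  have hvolCyl : (volume : Measure (ℝ × (Fin 3 → ℝ))) Cyl = ENNReal.ofReal (16 * r ^ 3) := by
    rw [hCyl, Measure.volume_eq_prod, Measure.prod_prod, Real.volume_Ioo,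
      Real.volume_pi_ball _ hr, Fintype.card_fin, ← ENNReal.ofReal_mul (by norm_num)]
    congr 1
    ring
  have hpre : (volume : Measure ℍ) (quatReImEquiv ⁻¹' Cyl) = ENNReal.ofReal (16 * r ^ 3) := by
    rw [measurePreserving_quatReImEquiv.measure_preimage hCylm.nullMeasurableSet, hvolCyl]
  rw [haarProbability_su2_eq_su2BallMeasure, su2BallMeasure, Measure.smul_apply,
    Measure.map_apply measurable_quatToSU2 hTm,
    Measure.restrict_apply (measurable_quatToSU2 hTm), smul_eq_mul]
  calc ((volume : Measure ℍ) (Metric.ball 0 1))⁻¹ *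
        (volume : Measure ℍ) (quatToSU2 ⁻¹' T ∩ Metric.ball 0 1)
      ≤ ((volume : Measure ℍ) (Metric.ball 0 1))⁻¹ * (volume : Measure ℍ) (quatReImEquiv ⁻¹' Cyl) :=
        mul_le_mul_right (measure_mono hsub) _
    _ = ENNReal.ofReal (16 * r ^ 3 / (Real.pi ^ 2 / 2)) := by
        rw [hpre, volume_ball_quat,
          show ENNReal.ofReal (16 * r ^ 3 / (Real.pi ^ 2 / 2)) =
              ENNReal.ofReal (16 * r ^ 3) / ENNReal.ofReal (Real.pi ^ 2 / 2) from
            ENNReal.ofReal_div_of_pos (by positivity),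
          ENNReal.div_eq_inv_mul]
    _ ≤ ENNReal.ofReal (4 * r ^ 3) := by
        refine ENNReal.ofReal_le_ofReal ?_
        rw [div_le_iff₀ (by positivity)]
        have hπ : (3 : ℝ) < Real.pi := Real.pi_gt_three
        have h9 : (9 : ℝ) < Real.pi ^ 2 := by nlinarith
        have h10 : r ^ 3 * 9 < r ^ 3 * Real.pi ^ 2 := mul_lt_mul_of_pos_left h9 (pow_pos hr 3)
        linarith [pow_pos hr 3]

end Literature.MathematicalPhysics.QuantumLattice

end
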